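import Summits.QuantumFields.YangMills.Theorems.FluctuationComparisonRegPrIntLLargeFieldGasBudget
import HarnessLib

/-!
# THE BUDGET `Ψ` MADE SMALL BY THE COUPLING CEILING: for `γ ≤ γ₁(ε)` the depth-uniform budget of ✓`…LargeFieldGasBudget` is `≤ ε·e^{−J}` — the rôle of LFG^{can}∘'s `∃ γ₁`
# in the Kotecký–Preiss rate condition of the knit (`hμ : Ψ J·s₀ + κℓ₀ + log m + 2 log Δ + Ψ J + 2 ≤ κμ`)

Cell `ym3-torus` (HUMAN RULING D-0037: rung R3 = continuum `SU(2)` Yang–Mills on `T³` — NOT `d = 4`, NOT infinite volume, NOT a mass gap, NOT the Clay problem); width seat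
`ym3-torus-px10` (gen 16); helper of the crux `stmt-QuantumFields-20520` `UnitScaleTilt.FluctuationComparisonRegPrIntL` (`--supports … --as helper`, NOT a proof of it); FILE 6,
sequel of ✓p789363 `…LargeFieldGasBudget` (whose witness `Ψ J = c₀·e^{A_L}·e^{−J}` decays in `J` but is NOT small at `J = 0`: `A_L = (3 log L + 1)²∕(4κ(log L∕2)²)` is tens).
THEOREMS ONLY: 0 `def`, 0 `instance`, 0 `notation`, 0 `sorry`, default heartbeats.

WHY.  In ✓p789065 `canIntBody_of_factorised_histories` (ymfull-r3-prover-1 g0) the pinned size `Ψ J` enters the rate condition ADDITIVELY against the expansion's per-cube decay `κμ`;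
a usable budget must therefore be uniformly SMALL, not merely decaying.  The smallness is exactly what LFG^{can}∘'s coupling ceiling `∃ γ₁, ∀ γ ≤ γ₁` buys: `p(g_i) ≥ 1 + log g_i⁻¹ =
1 + ½(i·log L + log γ⁻¹)`, so the small factor `e^{−κp(g_i)²}` carries, BESIDES its sub-Gaussian decay in the height `i` (✓`smallFactor_le_exp_neg_sq`), a coupling factor
`e^{−κ(log γ⁻¹)²∕4} → 0` as `γ → 0` ([Balaban1985UV3] (7) p.257: `p(g) = b₀(1 + log g⁻¹)^{p₀}`; the d = 3 effective coupling `g_k² = g²L^kε` is small at EVERY height once `g²` is).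
* §1 `smallFactor_le_exp_neg_sq_mul_coupling` — `e^{−κp(g_i)²} ≤ e^{−κ(log L∕2)²i²}·e^{−κ(log γ⁻¹∕2)²}` (`γ ≤ 1 ≤ b₀`, `1 ≤ p₀`, `0 ≤ κ`; `(a+b)² ≥ a² + b²`);
  `pow_mul_exp_neg_sq_le` — `L^{3i}·e^{−κ(log L∕2)²i²} ≤ e^{A_L}·e^{−i}` (complete the square, ✓`lin_sub_quad_le`).
* §2 `exp_neg_sq_log_le_rpow` — `e^{−κ(log γ⁻¹∕2)²} ≤ γ^{κ∕4}` for `0 < γ ≤ e⁻¹`; `exists_coupling_ceiling` — `∀ ε > 0, ∃ γ₁ ∈ (0, 1], ∀ γ ∈ (0, γ₁], C·e^{−κ(log γ⁻¹∕2)²} ≤ ε` (`C ≥ 0`,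
  `κ > 0`; `γ₁ := min e⁻¹ ((ε∕C)^{4∕κ})`).
* §3 ★★`exists_deep_budget_small` — for `1 < L`, `1 ≤ b₀`, `1 ≤ p₀`, `0 < κ`, `0 ≤ c₀` and EVERY `ε > 0`: `∃ γ₁ ∈ (0, 1], ∀ γ ∈ (0, γ₁], ∃ Ψ, (∀ J, 0 ≤ Ψ J ≤ ε) ∧ J·Ψ J → 0 ∧
  ∀ J S, (∀ i ∈ S, J < i) → Σ_{i ∈ S} c₀·L^{3(i−J)}·smallFactor L γ b₀ p₀ κ i ≤ Ψ J` — witness `Ψ J = c₀·e^{A_L}·e^{−κ(log γ⁻¹∕2)²}·e^{−J}`; quantifier order = LFG^{can}∘'s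
  (`∃ γ₁ … ∀ γ ≤ γ₁ … ∃ Ψ … ∀ J K`).

HONEST (CREDITS NOTHING): real analysis over ✓`smallFactor`; the per-cell label count, the rate `κμ` and everything of the 𝐑-operation ((R1∘-gas), XL, open) stay with the hand;
LFG^{can}∘ ∕ `stub_largeFieldFourPtIntCan` ∕ S2β ∕ the crux 20520 NOT proved; `YM3TorusSU2` NOT proved; the Yang–Mills mass gap (Clay) NOT proved; rung R3 = YM₃ on `T³` — NOT `d = 4`,
NOT infinite volume, NOT a mass gap.
References: [Balaban1985UV3] T. Bałaban, CMP 102 (1985): (3) p.256, (7) p.257, (67)–(71) pp.273–274; [Balaban1989LargeFieldII] CMP 122 (1989): (1.97) p.389, (1.100)–(1.101) p.390.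
-/

set_option autoImplicit false

noncomputable section

open Filter Topology
open Literature.MathematicalPhysics.QuantumFieldTheory.Balaban1983to89
open Summit.QuantumFields.YangMills.Theorems.FluctuationComparisonRegPrIntLHistoryPartition (smallFactor smallFactor_pos lin_sub_quad_le)
open Summit.QuantumFields.YangMills.Theorems.FluctuationComparisonRegPrIntLLargeFieldGasBudget (sum_exp_neg_shift_le tendsto_natCast_mul_exp_neg)

namespace Summit.QuantumFields.YangMills.Theorems.FluctuationComparisonRegPrIntLLargeFieldGasBudgetSmall

/-! ## §1 The small factor splits into a height factor and a coupling factor -/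

/-- **HEIGHT × COUPLING**: `e^{−κp(g_i)²} ≤ e^{−κ(log L∕2)²·i²}·e^{−κ(log γ⁻¹∕2)²}` for `0 < γ ≤ 1 ≤ b₀`, `1 ≤ p₀`, `0 ≤ κ` — `p(g_i) ≥ 1 + log g_i⁻¹ ≥ ½ i log L + ½ log γ⁻¹`, both
summands `≥ 0`, and `(a + b)² ≥ a² + b²`. [cite: Balaban1985UV3, (7) p.257 and (3) p.256] -/
theorem smallFactor_le_exp_neg_sq_mul_coupling {L : ℕ} (hL : 1 < L) {γ b₀ p₀ κ : ℝ} (hγ : 0 < γ) (hγ1 : γ ≤ 1) (hb : 1 ≤ b₀)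
    (hp : 1 ≤ p₀) (hκ : 0 ≤ κ) (i : ℕ) :
    smallFactor L γ b₀ p₀ κ i ≤
      Real.exp (-(κ * ((Real.log L / 2) ^ 2 * (i : ℝ) ^ 2))) * Real.exp (-(κ * (Real.log γ⁻¹ / 2) ^ 2)) := by
  unfold smallFactor
  rw [← Real.exp_add]
  apply Real.exp_le_exp.mpr
  have hL0 : (0 : ℝ) < L := by exact_mod_cast (zero_lt_one.trans hL)
  have hlogL : 0 ≤ Real.log L := Real.log_nonneg (by exact_mod_cast hL.le)
  have hlogγ : 0 ≤ Real.log γ⁻¹ := by rw [Real.log_inv]; linarith [Real.log_nonpos hγ.le hγ1]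
  have hin : 0 < γ * ((L : ℝ)⁻¹) ^ i := by positivity
  have hlog : Real.log (Real.sqrt (γ * ((L : ℝ)⁻¹) ^ i))⁻¹ = Real.log L / 2 * i + Real.log γ⁻¹ / 2 := by
    rw [Real.log_inv, Real.log_sqrt hin.le, Real.log_mul hγ.ne' (by positivity), Real.log_pow, Real.log_inv, Real.log_inv]
    ring
  set a : ℝ := Real.log L / 2 * i with ha
  set b : ℝ := Real.log γ⁻¹ / 2 with hb'
  have ha0 : 0 ≤ a := mul_nonneg (div_nonneg hlogL two_pos.le) (Nat.cast_nonneg i)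
  have hb0 : 0 ≤ b := div_nonneg hlogγ two_pos.le
  have hx1 : 1 ≤ 1 + Real.log (Real.sqrt (γ * ((L : ℝ)⁻¹) ^ i))⁻¹ := by rw [hlog]; linarith
  have hp' : a + b ≤ B10.pFun b₀ p₀ (Real.sqrt (γ * ((L : ℝ)⁻¹) ^ i)) := by
    unfold B10.pFun
    set x := 1 + Real.log (Real.sqrt (γ * ((L : ℝ)⁻¹) ^ i))⁻¹ with hx
    have hxp : x ≤ x ^ p₀ := by
      calc x = x ^ (1 : ℝ) := (Real.rpow_one x).symm
        _ ≤ x ^ p₀ := Real.rpow_le_rpow_of_exponent_le hx1 hp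
    have hx0 : 0 ≤ x ^ p₀ := Real.rpow_nonneg (by linarith) _
    calc a + b ≤ x := by rw [hx, hlog]; linarith
      _ ≤ x ^ p₀ := hxp
      _ = 1 * x ^ p₀ := (one_mul _).symm
      _ ≤ b₀ * x ^ p₀ := mul_le_mul_of_nonneg_right hb hx0
  have hsq : (a + b) ^ 2 ≤ (B10.pFun b₀ p₀ (Real.sqrt (γ * ((L : ℝ)⁻¹) ^ i))) ^ 2 := pow_le_pow_left₀ (by linarith) hp' 2
  have hab : a ^ 2 + b ^ 2 ≤ (a + b) ^ 2 := by nlinarith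
  have ha2 : (Real.log L / 2) ^ 2 * (i : ℝ) ^ 2 = a ^ 2 := by rw [ha]; ring
  rw [ha2]
  nlinarith [hsq, hab, hκ]

/-- **ONE HEIGHT, the Gaussian form**: `L^{3i}·e^{−κ(log L∕2)²i²} ≤ e^{A_L}·e^{−i}`, `A_L := (3 log L + 1)²∕(4κ(log L∕2)²)` (complete the square; the proof of ✓`pow_mul_smallFactor_le` with the
coupling factor set aside). [folklore] -/
theorem pow_mul_exp_neg_sq_le {L : ℕ} (hL : 1 < L) {κ : ℝ} (hκ : 0 < κ) (i : ℕ) :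
    ((L : ℝ)) ^ (3 * i) * Real.exp (-(κ * ((Real.log L / 2) ^ 2 * (i : ℝ) ^ 2))) ≤
      Real.exp ((3 * Real.log L + 1) ^ 2 / (4 * (κ * (Real.log L / 2) ^ 2))) * Real.exp (-(i : ℝ)) := by
  have hL0 : (0 : ℝ) < L := by exact_mod_cast (zero_lt_one.trans hL)
  have hlogL : 0 < Real.log L := Real.log_pos (by exact_mod_cast hL)
  have hβ : 0 < κ * (Real.log L / 2) ^ 2 := by positivity
  have hLpow : ((L : ℝ)) ^ (3 * i) = Real.exp (((3 * i : ℕ) : ℝ) * Real.log L) := by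
    rw [Real.exp_nat_mul, Real.exp_log hL0]
  rw [hLpow, ← Real.exp_add, ← Real.exp_add]
  apply Real.exp_le_exp.mpr
  have := lin_sub_quad_le (α := 3 * Real.log L + 1) hβ (i : ℝ)
  push_cast
  nlinarith [this]

/-! ## §2 The coupling factor is small for small coupling -/

/-- `e^{−κ(log γ⁻¹∕2)²} ≤ γ^{κ∕4}` for `0 < γ ≤ e⁻¹` (`t := log γ⁻¹ ≥ 1` ⇒ `t² ≥ t`, and `e^{−κt∕4} = γ^{κ∕4}`). [folklore] -/
theorem exp_neg_sq_log_le_rpow {γ κ : ℝ} (hγ : 0 < γ) (hγe : γ ≤ Real.exp (-1)) (hκ : 0 ≤ κ) :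
    Real.exp (-(κ * (Real.log γ⁻¹ / 2) ^ 2)) ≤ γ ^ (κ / 4) := by
  have ht : 1 ≤ Real.log γ⁻¹ := by
    rw [Real.log_inv, le_neg]
    have := Real.log_le_log hγ hγe
    rwa [Real.log_exp] at this
  have ht2 : Real.log γ⁻¹ ≤ (Real.log γ⁻¹) ^ 2 := by nlinarith
  rw [Real.rpow_def_of_pos hγ]
  apply Real.exp_le_exp.mpr
  have hlg : Real.log γ = -Real.log γ⁻¹ := by rw [Real.log_inv, neg_neg]
  rw [hlg]
  nlinarith [mul_le_mul_of_nonneg_left ht2 hκ]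

/-- **THE COUPLING CEILING**: for `C ≥ 0`, `κ > 0` and every `ε > 0` there is `γ₁ ∈ (0, 1]` with `C·e^{−κ(log γ⁻¹∕2)²} ≤ ε` for all `γ ∈ (0, γ₁]`
(`γ₁ := min e⁻¹ ((ε∕C)^{4∕κ})`). [folklore] -/
theorem exists_coupling_ceiling {C κ : ℝ} (hC : 0 ≤ C) (hκ : 0 < κ) {ε : ℝ} (hε : 0 < ε) :
    ∃ γ₁ : ℝ, 0 < γ₁ ∧ γ₁ ≤ 1 ∧ ∀ γ : ℝ, 0 < γ → γ ≤ γ₁ → C * Real.exp (-(κ * (Real.log γ⁻¹ / 2) ^ 2)) ≤ ε := by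
  rcases hC.eq_or_lt with hC0 | hCpos
  · refine ⟨1, one_pos, le_rfl, fun γ _ _ => ?_⟩
    rw [← hC0, zero_mul]; exact hε.le
  set δ : ℝ := ε / C with hδ
  have hδpos : 0 < δ := div_pos hε hCpos
  set γ₁ : ℝ := min (Real.exp (-1)) (δ ^ (4 / κ)) with hγ₁
  have hγ₁pos : 0 < γ₁ := lt_min (Real.exp_pos _) (Real.rpow_pos_of_pos hδpos _)
  have hγ₁le : γ₁ ≤ 1 := (min_le_left _ _).trans (by rw [← Real.exp_zero]; exact Real.exp_le_exp.mpr (by norm_num))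
  refine ⟨γ₁, hγ₁pos, hγ₁le, fun γ hγ hγle => ?_⟩
  have hγe : γ ≤ Real.exp (-1) := hγle.trans (min_le_left _ _)
  have hγδ : γ ≤ δ ^ (4 / κ) := hγle.trans (min_le_right _ _)
  have h1 : Real.exp (-(κ * (Real.log γ⁻¹ / 2) ^ 2)) ≤ γ ^ (κ / 4) := exp_neg_sq_log_le_rpow hγ hγe hκ.le
  have h2 : γ ^ (κ / 4) ≤ (δ ^ (4 / κ)) ^ (κ / 4) := Real.rpow_le_rpow hγ.le hγδ (by positivity)
  have h3 : (δ ^ (4 / κ)) ^ (κ / 4) = δ := by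
    rw [← Real.rpow_mul hδpos.le, show (4 / κ) * (κ / 4) = 1 by field_simp, Real.rpow_one]
  calc C * Real.exp (-(κ * (Real.log γ⁻¹ / 2) ^ 2)) ≤ C * δ := by
        refine mul_le_mul_of_nonneg_left ?_ hC
        exact h1.trans (h2.trans h3.le)
    _ = ε := by rw [hδ]; field_simp

/-! ## §3 The small depth-uniform budget -/

/-- ★★ **THE BUDGET, SMALL AND DECAYING, BELOW A COUPLING CEILING.**  For `1 < L`, `1 ≤ b₀`, `1 ≤ p₀`, `0 < κ`, `0 ≤ c₀` and every `ε > 0` there is `γ₁ ∈ (0, 1]` such that for every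
coupling `γ ∈ (0, γ₁]` some `Ψ : ℕ → ℝ` satisfies `0 ≤ Ψ J ≤ ε` for all `J`, `J·Ψ J → 0`, and dominates — for every comparison height `J` and every finite set `S` of heights above `J`,
whatever the run — `Σ_{i ∈ S} c₀·L^{3(i−J)}·smallFactor L γ b₀ p₀ κ i`.  Witness `Ψ J = c₀·e^{A_L}·e^{−κ(log γ⁻¹∕2)²}·e^{−J}`; the quantifier order is LFG^{can}∘'s (`∃ γ₁ … ∀ γ ≤ γ₁ … ∃ Ψ`).
[cite: Balaban1985UV3, (7) p.257 and (67)-(71) pp.273-274; Balaban1989LargeFieldII, (1.100)-(1.101) p.390] -/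
theorem exists_deep_budget_small {L : ℕ} (hL : 1 < L) {b₀ p₀ κ : ℝ} (hb : 1 ≤ b₀) (hp : 1 ≤ p₀) (hκ : 0 < κ) {c₀ : ℝ} (hc₀ : 0 ≤ c₀)
    {ε : ℝ} (hε : 0 < ε) :
    ∃ γ₁ : ℝ, 0 < γ₁ ∧ γ₁ ≤ 1 ∧ ∀ γ : ℝ, 0 < γ → γ ≤ γ₁ →
      ∃ Ψ : ℕ → ℝ, (∀ J, 0 ≤ Ψ J) ∧ (∀ J, Ψ J ≤ ε) ∧ Tendsto (fun J : ℕ => (J : ℝ) * Ψ J) atTop (𝓝 0) ∧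
        ∀ (J : ℕ) (S : Finset ℕ), (∀ i ∈ S, J < i) →
          ∑ i ∈ S, c₀ * ((L : ℝ)) ^ (3 * (i - J)) * smallFactor L γ b₀ p₀ κ i ≤ Ψ J := by
  set A : ℝ := Real.exp ((3 * Real.log L + 1) ^ 2 / (4 * (κ * (Real.log L / 2) ^ 2))) with hA
  have hA0 : 0 ≤ A := (Real.exp_pos _).le
  obtain ⟨γ₁, hγ₁, hγ₁1, hceil⟩ := exists_coupling_ceiling (C := c₀ * A) (mul_nonneg hc₀ hA0) hκ hε
  refine ⟨γ₁, hγ₁, hγ₁1, fun γ hγ hγle => ?_⟩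
  have hγ1 : γ ≤ 1 := hγle.trans hγ₁1
  set G : ℝ := Real.exp (-(κ * (Real.log γ⁻¹ / 2) ^ 2)) with hG
  have hG0 : 0 ≤ G := (Real.exp_pos _).le
  have hG1 : G ≤ 1 := by rw [hG, ← Real.exp_zero]; exact Real.exp_le_exp.mpr (by nlinarith [sq_nonneg (Real.log γ⁻¹ / 2), hκ.le])
  have hsmall : c₀ * A * G ≤ ε := hceil γ hγ hγle
  refine ⟨fun J => c₀ * A * G * Real.exp (-(J : ℝ)), fun J => by positivity, fun J => ?_, ?_, fun J S hS => ?_⟩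
  · have hJ : Real.exp (-(J : ℝ)) ≤ 1 := by rw [← Real.exp_zero]; exact Real.exp_le_exp.mpr (by simp)
    calc c₀ * A * G * Real.exp (-(J : ℝ)) ≤ c₀ * A * G * 1 := mul_le_mul_of_nonneg_left hJ (by positivity)
      _ ≤ ε := by rw [mul_one]; exact hsmall
  · have h := tendsto_natCast_mul_exp_neg (c₀ * A * G)
    refine h.congr fun J => ?_
    ring
  · have hL1 : (1 : ℝ) ≤ L := by exact_mod_cast hL.le
    have hterm : ∀ i ∈ S, c₀ * ((L : ℝ)) ^ (3 * (i - J)) * smallFactor L γ b₀ p₀ κ i ≤ c₀ * A * G * Real.exp (-(i : ℝ)) := by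
      intro i hi
      have hsf := smallFactor_le_exp_neg_sq_mul_coupling hL hγ hγ1 hb hp hκ.le i
      have hpow : ((L : ℝ)) ^ (3 * (i - J)) ≤ ((L : ℝ)) ^ (3 * i) := pow_le_pow_right₀ hL1 (by omega)
      have hsq := pow_mul_exp_neg_sq_le hL hκ i
      have hE0 : 0 ≤ Real.exp (-(κ * ((Real.log L / 2) ^ 2 * (i : ℝ) ^ 2))) := (Real.exp_pos _).le
      calc c₀ * ((L : ℝ)) ^ (3 * (i - J)) * smallFactor L γ b₀ p₀ κ i
          ≤ c₀ * ((L : ℝ)) ^ (3 * i) * (Real.exp (-(κ * ((Real.log L / 2) ^ 2 * (i : ℝ) ^ 2))) * G) := by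
            have h1 : c₀ * ((L : ℝ)) ^ (3 * (i - J)) ≤ c₀ * ((L : ℝ)) ^ (3 * i) := mul_le_mul_of_nonneg_left hpow hc₀
            exact mul_le_mul h1 hsf (smallFactor_pos L γ b₀ p₀ κ i).le (by positivity)
        _ = c₀ * (((L : ℝ)) ^ (3 * i) * Real.exp (-(κ * ((Real.log L / 2) ^ 2 * (i : ℝ) ^ 2)))) * G := by ring
        _ ≤ c₀ * (A * Real.exp (-(i : ℝ))) * G := by
            exact mul_le_mul_of_nonneg_right (mul_le_mul_of_nonneg_left hsq hc₀) hG0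
        _ = c₀ * A * G * Real.exp (-(i : ℝ)) := by ring
    calc ∑ i ∈ S, c₀ * ((L : ℝ)) ^ (3 * (i - J)) * smallFactor L γ b₀ p₀ κ i
        ≤ ∑ i ∈ S, c₀ * A * G * Real.exp (-(i : ℝ)) := Finset.sum_le_sum hterm
      _ = c₀ * A * G * ∑ i ∈ S, Real.exp (-(i : ℝ)) := by rw [Finset.mul_sum]
      _ ≤ c₀ * A * G * Real.exp (-(J : ℝ)) := mul_le_mul_of_nonneg_left (sum_exp_neg_shift_le J S hS) (by positivity)

end Summit.QuantumFields.YangMills.Theorems.FluctuationComparisonRegPrIntLLargeFieldGasBudgetSmall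

end
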